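import Summits.KontsevichZagierPeriods.KontsevichZagierPeriods.Theorems.LinRedNormalFormArrangementNormalFormStubRebaseSimpleZeroNestedDiffEdge
import Summits.KontsevichZagierPeriods.KontsevichZagierPeriods.Theorems.LinRedNormalFormArrangementNormalFormStubRebaseSimpleZeroNestedDiffGap

/-!
# Stub `stub_rebaseSimpleZeroTwo`, part `HPar1` (crux `ArrangementNormalForm`, line `janus-bands`)
— brick `NestedDiffE2Edge`

**Type A with the wall as the top section, ROBUST form** (`RebaseDiff.good_coreA_edge'`), the
version of `RebaseDiff.good_coreA_edge` needed by the E2 dissection. In the normalised frame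
(outer letter `κ` and top constant, inner letter `cᵢ` of slope `λ ≠ 0`, simple base pole `r`,
wall `ρ = cᵢ(r)`) let the clean nest `A(y) < tᵢ < tⱼ < ρ` have the wall as its top, the base pole
at a positive distance `m_y`, the inner letter OFF the domain (no margin: in the E2 configurations
the inner letter may touch the bottom at a corner of the base interval), and the outer letter
controlled by the ALTERNATIVE `m₀ ≤ |tⱼ − κ| ∨ m₀ ≤ ρ − tᵢ` (either `κ` keeps the distance `m₀`,
or — when `κ ≤ A` touches the bottom — the point is `m₀`-far from the wall). Then the letter piece
`P₁ = K/((tᵢ − ρ)(y − r)(tⱼ − κ))` of the edge expansion of `tᵢ` satisfies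
`|P₁| ≤ C₁/(ρ − tᵢ) + C₂ |f|`, hence converges by the wedge estimate
(`RebaseDiff.integrableOn_edge` for `1/(ρ − tᵢ)`), the frame piece converges as `f − P₁`, and the
two pieces are good as in `good_coreA_edge` (`RebaseDiff.good_any`, `RebaseDiff.good_frameA`).
Registered: `rebaseSimpleZero_nestedDiffAEdgeRobust`.

References: M. Kontsevich, D. Zagier, *Periods* (2001), §1.2, rules (1b), (2).
-/

noncomputable section

open Set MeasureTheory MvPolynomial
open Literature.NumberTheory.Transcendental Literature.ModelTheory.ExponentialFields

namespace Summit.KontsevichZagierPeriods.ArrangementNormalForm.JanusBands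

namespace RebaseDiff

open SeparatePos RebasePos RebaseZero RebaseNest

variable {m' : ℕ} {i j : Fin 2}

/-- The reciprocal wall distance `1/(tᵢ − ρ)` is semialgebraic. -/
theorem isSemialgebraicFunOn_inv_wall {S : Set (Fin (0 + 1 + 2) → ℝ)} (hS : IsSemialgebraic ℚ S) (i : Fin 2)
    (ρ : ℚ) : IsSemialgebraicFunOn ℚ S (fun z => 1 / (tv z i - ev (mk 0 ρ) (yv z))) := by
  have h1 : IsSemialgebraicFunOn ℚ S (fun _ => (1 : ℝ)) := by simpa using isSemialgebraicFunOn_ratCast hS 1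
  exact IntegrateOut.isSemialgebraicFunOn_div h1 (isSemialgebraicFunOn_letter hS i (mk 0 ρ))

/-- **The reciprocal wall distance converges on the nest under the wall.** On the clean nest
`A < tᵢ < tⱼ < ρ` the function `1/(tᵢ − ρ)` is absolutely integrable (wedge estimate). -/
theorem integrableOn_inv_wall (hij : i ≠ j) (M : Fin m' → Cf) (A : Cf) (ρ : ℚ) {D : Set (Fin (0 + 1 + 2) → ℝ)}
    (hD : D = gDom 0 2 m' M (nlo i A) (nhi j (mk 0 ρ))) (hbd : Bornology.IsBounded D) :
    IntegrableOn (fun z => 1 / (tv z i - ev (mk 0 ρ) (yv z))) D := by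
  have hS : IsSemialgebraic ℚ D := by rw [hD]; exact isSemialgebraic_gDom _ _ _ _
  refine integrableOn_edge hij M A ρ hD hbd (isSemialgebraicFunOn_inv_wall hS i ρ) 1 fun z hz => ?_
  obtain ⟨-, -, h2, h3⟩ := (mem_nDom hij M A (mk 0 ρ) z).1 (hD ▸ hz)
  rw [ev_mk, Rat.cast_zero, zero_mul, zero_add] at h3 ⊢
  rw [abs_div, abs_one, abs_of_neg (by linarith), neg_sub]

/-- **Type A with the wall as the top section, robust form.** A clean nest `A(y) < tᵢ < tⱼ < ρ`
whose constant top `ρ = cᵢ(r)` is the wall of the edge expansion of `tᵢ` to the slope `0` about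
the base pole `r`, with the literal integrand `K/((y − r)(tᵢ − cᵢ(y))(tⱼ − κ))` (`cᵢ` of slope
`λ ≠ 0`, `κ` constant), such that `|y − r| ≥ m_y > 0` on the domain, the inner letter does not
vanish there, and `m₀ ≤ |tⱼ − κ|` or `m₀ ≤ ρ − tᵢ` at every point (`m₀ > 0`), is good for
`GG 0 2 2`: the letter piece of the (non-dominated) edge expansion is bounded by
`C₁/(ρ − tᵢ) + C₂ |f|` hence converges (wedge estimate), the frame piece is the difference, the
letter piece has constant letters, the frame piece is `good_frameA`.
[Kontsevich–Zagier 2001, §1.2, rules (1b), (2)] -/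
theorem good_coreA_edge' (s : KZ.IntegralRep (0 + 1 + 2)) (hij : i ≠ j) (M : Fin m' → Cf) (A : Cf)
    (T : BData) (p : MvPolynomial (Fin 0) ℚ) (a : Fin 2 → Option Cf) (ci cj : Cf)
    (hi : a i = some ci) (hj : a j = some cj) (hcj : cj.1 (Fin.last 0) = 0) (h1 : T.n₁ = 0)
    (hn : T.n₂ = 1) (hlam : ci.1 (Fin.last 0) ≠ 0) (hbd : Bornology.IsBounded s.domain) (ρ : ℚ)
    (hρ : ρ = ci.2 - (0 - ci.1 (Fin.last 0)) * T.ℓ₂.2)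
    (hdom : s.domain = gDom 0 2 m' M (nlo i A) (nhi j (mk 0 ρ)))
    (hint : EqOn s.integrand (glitB T p a) s.domain) (my m₀ : ℝ) (hmy : 0 < my) (hm₀ : 0 < m₀)
    (hregy : ∀ z ∈ s.domain, my ≤ |yv z - T.ℓ₂.2|) (hne : ∀ z ∈ s.domain, tv z i ≠ ev ci (yv z))
    (halt : ∀ z ∈ s.domain, m₀ ≤ |tv z j - ev cj (yv z)| ∨ m₀ ≤ (ρ : ℝ) - tv z i) : Good 2 (KZ.of s) := by
  subst hρ
  set lam : ℚ := ci.1 (Fin.last 0) with hlamdef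
  set r : ℚ := T.ℓ₂.2 with hrdef
  set ρ : ℚ := ci.2 - (0 - lam) * r with hρdef
  have hrot : rot ci 0 r = mk 0 ρ := rfl
  have mD := fun z => mem_nDom hij M A (mk 0 ρ) z
  have hcjv : ∀ y : ℝ, ev cj y = cj.2 := fun y => by rw [ev, hcj, Rat.cast_zero, zero_mul, zero_add]
  have hy : ∀ z ∈ s.domain, yv z ≠ r := fun z hz h => by
    have := hregy z hz; rw [h, sub_self, abs_zero] at this; exact absurd this (not_le.2 hmy)
  -- on the domain `tᵢ < tⱼ < ρ`, so the wall `tᵢ = ρ` is the top edge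
  have hR : ∀ z ∈ s.domain, tv z i < tv z j ∧ tv z j < ρ := fun z hz => by
    obtain ⟨-, -, h2, h3⟩ := (mD z).1 (hdom ▸ hz)
    rw [ev_mk, Rat.cast_zero, zero_mul, zero_add] at h3
    exact ⟨h2, h3⟩
  have hρi : ∀ z ∈ s.domain, 0 < (ρ : ℝ) - tv z i := fun z hz => by
    have h3 := hR z hz; linarith [h3.1, h3.2]
  have hRv : ∀ z, tv z i - ev (rot ci 0 r) (yv z) = tv z i - ρ := fun z => by
    rw [hrot, ev_mk, Rat.cast_zero, zero_mul, zero_add]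
  have hsa := s.isSemialgebraic_domain
  have hDm : MeasurableSet s.domain := KZ.IntegralRep.measurableSet_domain_holds s
  -- the literal integrand and its absolute value
  have hlit : ∀ z ∈ s.domain, s.integrand z = Kc T p * (1 / (yv z - r)) *
      ((1 / (tv z i - ev ci (yv z))) * (1 / (tv z j - cj.2))) := fun z hz => by
    rw [hint hz, glitB_two T p a hij ci cj hi hj h1 hn, hcjv]
  have hf_abs : ∀ z ∈ s.domain, |s.integrand z| = |Kc T p| * (1 / |yv z - r|) *
      ((1 / |tv z i - ev ci (yv z)|) * (1 / |tv z j - cj.2|)) := fun z hz => by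
    rw [hlit z hz]; simp only [abs_mul, abs_div, abs_one]
  have hL_abs : ∀ z ∈ s.domain, |facL i ci 0 r z| = |tv z i - ev ci (yv z)| / ((ρ : ℝ) - tv z i) := fun z hz => by
    rw [facL, hRv, abs_div, abs_sub_comm (tv z i) (ρ : ℝ), abs_of_pos (hρi z hz)]
  -- the two dominating functions
  obtain ⟨P, hP, hPle⟩ := exists_letter_bound s hbd i ci
  set g₀ : (Fin (0 + 1 + 2) → ℝ) → ℝ := fun z => 1 / (tv z i - ev (mk 0 ρ) (yv z)) with hg₀
  have hg₀v : ∀ z ∈ s.domain, ‖g₀ z‖ = 1 / ((ρ : ℝ) - tv z i) := fun z hz => by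
    rw [Real.norm_eq_abs, hg₀]
    show |1 / (tv z i - ev (mk 0 ρ) (yv z))| = _
    rw [ev_mk, Rat.cast_zero, zero_mul, zero_add, abs_div, abs_one, abs_of_neg (by linarith [hρi z hz]), neg_sub]
  have hIg₀ : IntegrableOn g₀ s.domain := integrableOn_inv_wall hij M A ρ hdom hbd
  set C₁ : ℝ := |Kc T p| / (my * m₀) with hC₁
  set C₂ : ℝ := P / m₀ with hC₂
  have hC₁0 : 0 ≤ C₁ := by positivity
  have hC₂0 : 0 ≤ C₂ := by positivity
  -- the pointwise bound of the letter piece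
  have hbound : ∀ z ∈ s.domain, ‖s.integrand z * facL i ci 0 r z‖ ≤ C₁ * ‖g₀ z‖ + C₂ * ‖s.integrand z‖ := by
    intro z hz
    rw [Real.norm_eq_abs, hg₀v z hz, Real.norm_eq_abs, abs_mul, hL_abs z hz]
    have hρ0 := hρi z hz
    have hPi : 0 < |tv z i - ev ci (yv z)| := abs_pos.2 (sub_ne_zero.2 (hne z hz))
    have hyr : 0 < |yv z - (r : ℝ)| := abs_pos.2 (sub_ne_zero.2 (hy z hz))
    have hf0 : 0 ≤ |s.integrand z| := abs_nonneg _
    have hT1 : 0 ≤ C₁ * (1 / ((ρ : ℝ) - tv z i)) := by positivity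
    have hT2 : 0 ≤ C₂ * |s.integrand z| := by positivity
    rcases halt z hz with hκ | hw
    · -- the outer letter keeps the distance `m₀`
      have hκ' : m₀ ≤ |tv z j - (cj.2 : ℝ)| := by rwa [hcjv] at hκ
      have key : |s.integrand z| * (|tv z i - ev ci (yv z)| / (↑ρ - tv z i)) ≤ C₁ * (1 / ((ρ : ℝ) - tv z i)) := by
        rw [hf_abs z hz]
        calc |Kc T p| * (1 / |yv z - ↑r|) * (1 / |tv z i - ev ci (yv z)| * (1 / |tv z j - ↑cj.2|)) *
              (|tv z i - ev ci (yv z)| / (↑ρ - tv z i))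
            = |Kc T p| * (1 / |yv z - ↑r|) * (1 / |tv z j - ↑cj.2|) * (1 / (↑ρ - tv z i)) := by field_simp
          _ ≤ |Kc T p| * (1 / my) * (1 / m₀) * (1 / (↑ρ - tv z i)) := by
              gcongr
              exact hregy z hz
          _ = C₁ * (1 / ((ρ : ℝ) - tv z i)) := by rw [hC₁]; field_simp
      linarith
    · -- the point is `m₀`-far from the wall
      have key : |s.integrand z| * (|tv z i - ev ci (yv z)| / (↑ρ - tv z i)) ≤ C₂ * |s.integrand z| := by
        rw [mul_comm C₂]
        refine mul_le_mul_of_nonneg_left ?_ hf0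
        rw [hC₂, div_le_div_iff₀ hρ0 hm₀]
        exact mul_le_mul (hPle z hz) hw hm₀.le hP.le
      linarith
  -- convergence of the letter piece
  have hsa₁ := IsSemialgebraicFunOn.mul_holds s.isSemialgebraicFunOn_integrand (isSemialgebraicFunOn_facL hsa i ci 0 r)
  have hI₁ : IntegrableOn (fun z => s.integrand z * facL i ci 0 r z) s.domain := by
    refine Integrable.mono' ((hIg₀.norm.const_mul C₁).add (s.integrableOn.norm.const_mul C₂))
      (KZ.aestronglyMeasurable_of_isSemialgebraicFunOn hsa₁ hDm) ?_
    exact (ae_restrict_iff' hDm).2 (Filter.Eventually.of_forall fun z hz => hbound z hz)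
  -- convergence of the frame piece: it is the difference `f − f · facL`
  have hI₂ : IntegrableOn (fun z => s.integrand z * facF i ci 0 r z) s.domain := by
    refine (s.integrableOn.sub hI₁).congr_fun (fun z hz => ?_) hDm
    have hRz : tv z i - ev (rot ci 0 r) (yv z) ≠ 0 := by rw [hRv]; exact fun h => by linarith [hρi z hz]
    show s.integrand z - s.integrand z * facL i ci 0 r z = s.integrand z * facF i ci 0 r z
    have h := facL_add_facF i ci 0 r z hRz
    calc s.integrand z - s.integrand z * facL i ci 0 r z
        = s.integrand z * (facL i ci 0 r z + facF i ci 0 r z) - s.integrand z * facL i ci 0 r z := by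
          rw [h, mul_one]
      _ = s.integrand z * facF i ci 0 r z := by ring
  -- rule (1b) with the convergence just proved
  obtain ⟨s₁, s₂, hd₁, hd₂, hi₁, hi₂, hrel⟩ := split_of_integrable s _ _ hsa₁
    (IsSemialgebraicFunOn.mul_holds s.isSemialgebraicFunOn_integrand (isSemialgebraicFunOn_facF hsa i ci 0 r))
    hI₁ hI₂ (fun z hz => by
      have hRz : tv z i - ev (rot ci 0 r) (yv z) ≠ 0 := by
        rw [hRv]; have := hR z hz; exact fun h => by linarith
      show s.integrand z = s.integrand z * facL i ci 0 r z + s.integrand z * facF i ci 0 r z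
      rw [← mul_add, facL_add_facF i ci 0 r z hRz, mul_one])
  refine good_of_rel3 hrel ?_ ?_
  · -- the letter piece: constant letters `ρ, κ`
    refine good_any s₁ M T.L T.e p T.ℓ₁ T.ℓ₂ (Function.update a i (some (rot ci 0 r))) (nlo i A)
      (nhi j (mk 0 ρ)) h1 hn ⟨0, fun l c hc => ?_⟩ (hd₁ ▸ hbd) (hd₁.trans hdom) fun z hz => ?_
    · rcases fin_two_eq_or hij l with rfl | rfl
      · rw [Function.update_self] at hc; cases hc; rfl
      · rw [Function.update_of_ne hij.symm, hj] at hc; cases hc; exact hcj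
    · rw [hd₁] at hz
      rw [hi₁]
      show s.integrand z * facL i ci 0 r z = glitB T p (Function.update a i (some (rot ci 0 r))) z
      rw [hint hz, glitB_update_letter T p a i ci (rot ci 0 r) hi z (hne z hz), facL]
  · -- the frame piece
    exact good_frameA s₂ hij M A ρ T p a ci cj hi hj hcj h1 hn hlam (hd₂ ▸ hbd) (hd₂.trans hdom)
      (fun z hz => by rw [hi₂, Pi.mul_apply, hint (hd₂ ▸ hz)]) (fun z hz => hne z (hd₂ ▸ hz))
      (fun z hz h => by
        have := hR z (hd₂ ▸ hz); rw [← sub_eq_zero, hRv] at h; linarith)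
      (fun z hz => hy z (hd₂ ▸ hz))

end RebaseDiff

/-- **Registered brick `rebaseSimpleZero_nestedDiffAEdgeRobust` of the part `HPar1` (stub
`stub_rebaseSimpleZeroTwo`, line `janus-bands`): type A with the wall as the top section, robust
form.** A clean nest `A(y) < tᵢ < tⱼ < ρ` (literal `GS 0 2` integrand with simple base pole
`r = ℓ₂.2`, inner letter of slope `λ ≠ 0`, outer letter constant `κ`) whose constant top IS the
wall `ρ = cᵢ(r)` of the edge expansion of `tᵢ`, with the base pole at a positive distance, the
inner letter off the domain and `m₀ ≤ |tⱼ − κ| ∨ m₀ ≤ ρ − tᵢ` pointwise (`m₀ > 0`), is congruent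
modulo `KZ.relations` to the subgroup generated by `GG 0 2 2` (`RebaseDiff.good_coreA_edge'`).
This is the LOWER piece of the E2 dissection. [Kontsevich–Zagier 2001, §1.2] -/
theorem rebaseSimpleZero_nestedDiffAEdgeRobust (m' : ℕ) (i j : Fin 2) (s : KZ.IntegralRep (0 + 1 + 2)) (hij : i ≠ j) (M : Fin m' → (Fin (0 + 1) → ℚ) × ℚ) (A : (Fin (0 + 1) → ℚ) × ℚ) (T : RebaseZero.BData) (p : MvPolynomial (Fin 0) ℚ) (a : Fin 2 → Option ((Fin (0 + 1) → ℚ) × ℚ)) (ci cj : (Fin (0 + 1) → ℚ) × ℚ) (hi : a i = some ci) (hj : a j = some cj) (hcj : cj.1 (Fin.last 0) = 0) (h1 : T.n₁ = 0) (hn : T.n₂ = 1) (hlam : ci.1 (Fin.last 0) ≠ 0) (hbd : Bornology.IsBounded s.domain) (ρ : ℚ) (hρ : ρ = ci.2 - (0 - ci.1 (Fin.last 0)) * T.ℓ₂.2) (hdom : s.domain = SeparatePos.gDom 0 2 m' M (RebaseNest.nlo i A) (RebaseNest.nhi j (RebaseZero.mk 0 ρ))) (hint : EqOn s.integrand (RebaseZero.glitB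 T p a) s.domain) (my m₀ : ℝ) (hmy : 0 < my) (hm₀ : 0 < m₀) (hregy : ∀ z ∈ s.domain, my ≤ |RebaseZero.yv z - T.ℓ₂.2|) (hne : ∀ z ∈ s.domain, RebaseZero.tv z i ≠ RebaseZero.ev ci (RebaseZero.yv z)) (halt : ∀ z ∈ s.domain, m₀ ≤ |RebaseZero.tv z j - RebaseZero.ev cj (RebaseZero.yv z)| ∨ m₀ ≤ (ρ : ℝ) - RebaseZero.tv z i) : ∃ c ∈ AddSubgroup.closure (SeparatePos.GGset 0 2 2), KZ.of s - c ∈ KZ.relations :=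
  RebaseDiff.good_coreA_edge' s hij M A T p a ci cj hi hj hcj h1 hn hlam hbd ρ hρ hdom hint my m₀ hmy hm₀ hregy hne halt

end Summit.KontsevichZagierPeriods.ArrangementNormalForm.JanusBands
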